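import Summits.Ventures.YMGap.Census.TwistCensusSupport
import HarnessLib

/-!
# Venture YMGap, track (b) census — first STRUCTURE theorems for the census polynomials on a rectangular torus:
# coefficient formulas, degree bounds, the top-coefficient identity `Z⁻_top = (−1)^{|V|} Z_top`, and class invariance

HONEST FRAMING: venture file of the cell `pub-ymgap` (QuantumFields programme), track (b).  Exact algebra of the
one-character census polynomials of `Census/TwistCensusObjects.lean`; nothing about signs of `N`, root locations, limits
or physics.  These are the parts of mechanism N-3 (HOME/STRUCTURE.md §4) that are bookkeeping, made theorems for EVERY
rectangular torus (all `d`, all side vectors):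

* `oneCharZtwPoly_coeff` / `oneCharZPoly_coeff`: `coeff_k Z⁻_V = 2^k Σ_{|S| = k} (−1)^{|S ∩ V|} I(S)`;
* `oneCharZtwPoly_coeff_eq_zero` (`k > |Λ₂|`), `natDegree_oneCharZtwPoly_le`, `natDegree_twistCensusPoly_le`
  (`deg N_V ≤ 2|Λ₂| − 1`; the degree LAW (D) `= 2|Λ₂| − 1 − L_iL_j` is the conjecture);
* `oneCharZtwPoly_coeff_card` — **top identity**: `coeff_{|Λ₂|} Z⁻_V = (−1)^{|V|} coeff_{|Λ₂|} Z` (only `S = Λ₂` has full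
  size; cubic case = `OneCharacterExpansion.torusZtw_one_sub_sign_mul_torusZ`) — the column «Z⁻_top = (−1)^n Z_top» of the
  evidence table HOME/engine/census/TwistCensusParity/c1_direct_leg.md (127/127) is thereby a theorem for all tori;
* `oneCharZtwPoly_symmDiff_coboundary`, `twistCensusPoly_symmDiff_coboundary` — **class invariance**: `Z⁻_V` and `N_V` as
  POLYNOMIALS depend on the twist set only modulo coboundaries (support rule of `TwistCensusSupport`), so the census
  polynomial of a plane is the same for every representative of the twist class (translated stacks etc.).

References: E. T. Tomboulis, arXiv:0707.2179 §4 (after (4.1)), §6 (6.2)–(6.4) [cite: Tomboulis2007Confinement, §6 eqs. (6.2)–(6.4)].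
-/

noncomputable section

open MeasureTheory Finset Real Polynomial
open scoped BigOperators symmDiff
open Literature.MathematicalPhysics.QuantumLattice
open Literature.MathematicalPhysics.QuantumFieldTheory
open Literature.MathematicalPhysics.QuantumFieldTheory.Tomboulis2007

namespace Summit.Ventures.YMGap.Census

variable {d : ℕ} (Ls : Fin d → ℕ) [∀ i, NeZero (Ls i)]

/-! ### Coefficients -/

/-- **Coefficient formula**: `coeff_k Z⁻_V = Σ_{S, |S| = k} 2^{|S|} (−1)^{|S ∩ V|} I(S)`. -/
theorem oneCharZtwPoly_coeff (V : Finset (RectPlaquette Ls)) (k : ℕ) :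
    (oneCharZtwPoly Ls V).coeff k = ∑ S ∈ ((univ : Finset (RectPlaquette Ls)).powerset).filter (fun S => S.card = k),
      (2 : ℝ) ^ S.card * (-1 : ℝ) ^ (S ∩ V).card * rectCharMoment Ls S := by
  unfold oneCharZtwPoly
  rw [finsetSum_coeff, Finset.sum_filter]
  refine Finset.sum_congr rfl fun S _ => ?_
  rw [coeff_C_mul, coeff_X_pow]
  by_cases h : S.card = k
  · rw [if_pos h, if_pos h.symm, mul_one]
  · rw [if_neg h, if_neg (fun h' => h h'.symm), mul_zero]

/-- **Coefficient formula**, untwisted: `coeff_k Z = Σ_{S, |S| = k} 2^{|S|} I(S)`. -/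
theorem oneCharZPoly_coeff (k : ℕ) :
    (oneCharZPoly Ls).coeff k = ∑ S ∈ ((univ : Finset (RectPlaquette Ls)).powerset).filter (fun S => S.card = k),
      (2 : ℝ) ^ S.card * rectCharMoment Ls S := by
  unfold oneCharZPoly
  rw [finsetSum_coeff, Finset.sum_filter]
  refine Finset.sum_congr rfl fun S _ => ?_
  rw [coeff_C_mul, coeff_X_pow]
  by_cases h : S.card = k
  · rw [if_pos h, if_pos h.symm, mul_one]
  · rw [if_neg h, if_neg (fun h' => h h'.symm), mul_zero]

/-- `Z` is `Z⁻` with the empty twist, as polynomials. -/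
theorem oneCharZtwPoly_empty : oneCharZtwPoly Ls ∅ = oneCharZPoly Ls := by
  unfold oneCharZtwPoly oneCharZPoly
  refine Finset.sum_congr rfl fun S _ => ?_
  rw [Finset.inter_empty, Finset.card_empty, pow_zero, mul_one]

/-- Coefficients beyond the number of plaquettes vanish. -/
theorem oneCharZtwPoly_coeff_eq_zero (V : Finset (RectPlaquette Ls)) {k : ℕ}
    (hk : Fintype.card (RectPlaquette Ls) < k) : (oneCharZtwPoly Ls V).coeff k = 0 := by
  rw [oneCharZtwPoly_coeff]
  refine Finset.sum_eq_zero fun S hS => ?_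
  exfalso
  have hcard : S.card = k := (Finset.mem_filter.mp hS).2
  have : S.card ≤ Fintype.card (RectPlaquette Ls) := Finset.card_le_univ S
  omega

/-- `deg Z⁻_V ≤ |Λ₂|`. -/
theorem natDegree_oneCharZtwPoly_le (V : Finset (RectPlaquette Ls)) :
    (oneCharZtwPoly Ls V).natDegree ≤ Fintype.card (RectPlaquette Ls) := by
  rw [natDegree_le_iff_coeff_eq_zero]
  intro k hk
  exact oneCharZtwPoly_coeff_eq_zero Ls V (by exact_mod_cast hk)

/-- `deg Z ≤ |Λ₂|`. -/
theorem natDegree_oneCharZPoly_le : (oneCharZPoly Ls).natDegree ≤ Fintype.card (RectPlaquette Ls) := by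
  rw [← oneCharZtwPoly_empty]; exact natDegree_oneCharZtwPoly_le Ls ∅

/-- `deg N_V ≤ 2|Λ₂| − 1` (bookkeeping bound; the degree LAW (D) of `Conjectures/TwistCensusParity.lean` is the sharp
value `2|Λ₂| − 1 − L_iL_j`). -/
theorem natDegree_twistCensusPoly_le (V : Finset (RectPlaquette Ls)) :
    (twistCensusPoly Ls V).natDegree ≤ 2 * Fintype.card (RectPlaquette Ls) - 1 := by
  have h1 := natDegree_oneCharZtwPoly_le Ls V
  have h2 := natDegree_oneCharZPoly_le Ls
  have h3 := natDegree_derivative_le (oneCharZtwPoly Ls V)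
  have h4 := natDegree_derivative_le (oneCharZPoly Ls)
  unfold twistCensusPoly
  refine (natDegree_sub_le _ _).trans (max_le ?_ ?_)
  · refine natDegree_mul_le.trans ?_
    omega
  · refine natDegree_mul_le.trans ?_
    omega

/-! ### The top-coefficient identity -/

/-- **Top identity** `coeff_{|Λ₂|} Z⁻_V = (−1)^{|V|} · coeff_{|Λ₂|} Z`: the only plaquette set of full size is `Λ₂` itself,
on which the twist sign is `(−1)^{|V|}` (mechanism N-3 (ii), first half; cubic case in `OneCharacterExpansion`).
[cite: Tomboulis2007Confinement, §6 eqs. (6.2)–(6.4)] -/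
theorem oneCharZtwPoly_coeff_card (V : Finset (RectPlaquette Ls)) :
    (oneCharZtwPoly Ls V).coeff (Fintype.card (RectPlaquette Ls)) =
      (-1 : ℝ) ^ V.card * (oneCharZPoly Ls).coeff (Fintype.card (RectPlaquette Ls)) := by
  have hfilter : ((univ : Finset (RectPlaquette Ls)).powerset).filter
      (fun S => S.card = Fintype.card (RectPlaquette Ls)) = {univ} := by
    ext S
    simp only [Finset.mem_filter, Finset.mem_powerset, Finset.subset_univ, true_and, Finset.mem_singleton]
    constructor
    · intro h; exact Finset.eq_univ_of_card S h
    · intro h; rw [h, Finset.card_univ]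
  rw [oneCharZtwPoly_coeff, oneCharZPoly_coeff, hfilter, Finset.sum_singleton, Finset.sum_singleton, Finset.univ_inter]
  ring

/-! ### Parity plumbing -/

omit [∀ i, NeZero (Ls i)] in
/-- `(-1)^m = (-1)^n` when `m + n` is even. [folklore] -/
private theorem neg_one_pow_eq_of_even_add {m n : ℕ} (h : Even (m + n)) : (-1 : ℝ) ^ m = (-1) ^ n := by
  have h1 : (-1 : ℝ) ^ m * (-1) ^ n = 1 := by rw [← pow_add]; exact h.neg_one_pow
  have h2 : (-1 : ℝ) ^ n * (-1) ^ n = 1 := by rw [← mul_pow]; norm_num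
  calc (-1 : ℝ) ^ m = (-1) ^ m * ((-1) ^ n * (-1) ^ n) := by rw [h2, mul_one]
    _ = ((-1) ^ m * (-1) ^ n) * (-1) ^ n := by ring
    _ = (-1) ^ n := by rw [h1, one_mul]

omit [∀ i, NeZero (Ls i)] in
/-- `(-1)^{|A ∆ B|} = (-1)^{|A|}` when `|B|` is even (`|A ∆ B| + |A| = 2|A ∖ B| + |B|`). [folklore] -/
private theorem neg_one_pow_card_symmDiff_of_even {α : Type*} [DecidableEq α] (A B : Finset α) (hB : Even B.card) :
    (-1 : ℝ) ^ (A ∆ B).card = (-1) ^ A.card := by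
  apply neg_one_pow_eq_of_even_add
  have hunion : (A ∆ B).card = (A \ B).card + (B \ A).card := by
    rw [symmDiff_def, Finset.sup_eq_union]
    exact (Finset.card_union_eq_card_add_card).mpr disjoint_sdiff_sdiff
  have hA : (A \ B).card + (A ∩ B).card = A.card := Finset.card_sdiff_add_card_inter A B
  have hB' : (B \ A).card + (B ∩ A).card = B.card := Finset.card_sdiff_add_card_inter B A
  rw [Finset.inter_comm B A] at hB'
  obtain ⟨m, hm⟩ := hB
  exact ⟨(A \ B).card + m, by omega⟩

/-! ### Class invariance: the polynomials depend on the twist only modulo coboundaries -/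

/-- **`Z⁻_V` as a polynomial is invariant under `V ↦ V ∆ δE`** (support rule: `I(S) ≠ 0` forces `|S ∩ δE|` even, so the
twist signs `(−1)^{|S ∩ V|}` and `(−1)^{|S ∩ (V ∆ δE)|}` agree on every contributing `S`). [cite: Tomboulis2007Confinement, §4 (text after eq. (4.1))] -/
theorem oneCharZtwPoly_symmDiff_coboundary (V : Finset (RectPlaquette Ls)) (E : Finset (RectEdge Ls)) :
    oneCharZtwPoly Ls (V ∆ rectCoboundary E) = oneCharZtwPoly Ls V := by
  unfold oneCharZtwPoly
  refine Finset.sum_congr rfl fun S _ => ?_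
  by_cases hI : rectCharMoment Ls S = 0
  · simp [hI]
  · have heven : Even (S ∩ rectCoboundary E).card := even_inter_rectCoboundary_of_rectCharMoment_ne_zero Ls hI E
    have hsign : (-1 : ℝ) ^ (S ∩ (V ∆ rectCoboundary E)).card = (-1 : ℝ) ^ (S ∩ V).card := by
      have hsd : S ∩ (V ∆ rectCoboundary E) = (S ∩ V) ∆ (S ∩ rectCoboundary E) := by
        ext p
        simp only [Finset.mem_inter, Finset.mem_symmDiff]
        tauto
      rw [hsd]
      exact neg_one_pow_card_symmDiff_of_even _ _ heven
    rw [hsign]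

/-- **The census polynomial depends on the twist only through its class modulo coboundaries.**
[cite: Tomboulis2007Confinement, §4 (text after eq. (4.1))] -/
theorem twistCensusPoly_symmDiff_coboundary (V : Finset (RectPlaquette Ls)) (E : Finset (RectEdge Ls)) :
    twistCensusPoly Ls (V ∆ rectCoboundary E) = twistCensusPoly Ls V := by
  unfold twistCensusPoly
  rw [oneCharZtwPoly_symmDiff_coboundary]

end Summit.Ventures.YMGap.Census

end
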